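import Mathlib.Geometry.Manifold.VectorBundle.Riemannian
import Mathlib.Geometry.Manifold.MFDeriv.Basic
import Literature.Geometry.Lorentzian.PseudoRiemannianMetric
import Literature.Geometry.Lorentzian.LorentzianMetric
import Literature.Geometry.Lorentzian.LeviCivita
import Literature.Geometry.Lorentzian.Geodesic
import HarnessLib

-- provenance: harness21/H21/H21/Prelude/Lorentz/InitialData.lean @ f49aa4e (interim HEAD d8f2665); M5 mechanical rewrite
/-!
# Initial data sets and the Einstein constraint equations (trunk T-LORENTZ / G08, family `gr`)

An **initial data set** for the Einstein equations is a triple `(X, h, k)` consisting of a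
manifold `X` (informally `Σ`; `Σ` is a Lean token), a smooth Riemannian metric `h` on `X` and a
smooth symmetric `2`-tensor `k` on `X` (the second fundamental form of `X` inside the sought
spacetime, taken with respect to the *future* unit normal `ν` in the sign convention
`K_ν(v, w) = + g(D_v ν, df w)` of the outline, decision (h)). The Gauss–Codazzi equations of a
spacelike hypersurface in a spacetime satisfying the Einstein equations force the
**constraint equations**
`R(h) - |k|²_h + (tr_h k)² = 16π μ` (Hamiltonian constraint) and
`div_h k - d(tr_h k) = 8π J` (momentum constraint),
where `μ` and `J` are the energy and momentum densities of the matter fields seen by the normal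
observer; in vacuum `μ = 0`, `J = 0`. The dominant energy condition reads `|J|_h ≤ μ`.

## Main definitions (namespace `Literature.Lorentz`)

* `InitialDataSet I X`: the structure `(h, k)` (**gr.S14**).
* `InitialDataSet.metric`, `traceK`, `normSqK`: `h` as a `PseudoRiemannianMetric`, `tr_h k`,
  `|k|²_h`.
* `InitialDataSet.hamiltonianConstraintFn`, `momentumConstraintFn`, `energyDensity`,
  `momentumDensity`: the two sides of the constraint equations.
* `InitialDataSet.IsVacuumConstraintSolution`, `SatisfiesDominantEnergyCondition`,
  `IsMaximalData`, `IsTimeSymmetric`, `IsComplete`, `restrict`.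

## Mathlib

Mathlib has smooth Riemannian metrics on vector bundles (`Bundle.ContMDiffRiemannianMetric`),
which we use for `h`, and `mfderiv` for `d(tr k)`; it has no second fundamental form, scalar
curvature, divergence or constraint equations (`rg -i "constraint equation|second fundamental|
initial data" Mathlib/Geometry` finds nothing relevant). Curvature, trace, divergence and geodesic
completeness come from the H21 modules `PseudoRiemannianMetric`, `LeviCivita`, `Geodesic`.

## Design choices

* `k x` is a *continuous* bilinear form `T_x X →L[ℝ] T_x X →L[ℝ] ℝ` (like `h.inner x`), so that
  smoothness of `k` is smoothness of a section of `Hom(TX, Hom(TX, ℝ))`, verbatim as for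
  `ContMDiffRiemannianMetric.contMDiff`.
* No global `FiniteDimensional ℝ (TangentSpace I x)` instance is used; the pointwise algebra goes
  through `PseudoRiemannianMetric.trace/normSq/innerDual`, which obtain it locally.
* The constraint *functions* are defined for arbitrary data; the vacuum constraints are the
  vanishing of both, and are insensitive to the sign convention for `k`.
* Completeness of the data is geodesic completeness of the Levi-Civita connection of `h`
  (equivalent to metric completeness by Hopf–Rinow, not in Mathlib).
* **Standing hypothesis `[D.metric.HasLeviCivita]`.** Every notion built on the Levi-Civita
  connection of `h` (scalar curvature, divergence, geodesic completeness: the constraint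
  functions, `energyDensity`, `momentumDensity`, `IsVacuumConstraintSolution`,
  `SatisfiesDominantEnergyCondition`, `IsComplete`) takes the instance argument
  `[D.metric.HasLeviCivita]` of `LeviCivita` (the named fact
  `PseudoRiemannianMetric.isCovariantDerivativeOn_leviCivitaFun`, supplied by `HasLeviCivita.of`).
* **Restriction.** `D.restrict hres hk U` takes the two (true, Mathlib-level) named facts
  `hres : PseudoRiemannianMetric.contMDiff_restrict` (file `LorentzianMetric`) and
  `hk : InitialDataSet.contMDiff_k_restrict` (this file) as explicit parameters, following the
  pattern of `PseudoRiemannianMetric.restrict`; downstream users (`CosmicCensorship`,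
  `MassInequalities`, `ModelData`) thread them likewise.

## References

* Y. Choquet-Bruhat, *General Relativity and the Einstein Equations* (2009), Ch. VI–VII.
* R. Bartnik, J. Isenberg, *The constraint equations*, in: The Einstein equations and the large
  scale behavior of gravitational fields (2004), §2.
* R. Wald, *General Relativity* (1984), (10.2.28)–(10.2.30) and App. E.2.
-/

open Manifold Bundle TopologicalSpace
open scoped ContDiff Topology

noncomputable section

namespace Literature.Geometry.Lorentzian

variable {E : Type*} [NormedAddCommGroup E] [NormedSpace ℝ E] {H : Type*} [TopologicalSpace H]
  (I : ModelWithCorners ℝ E H) (X : Type*) [TopologicalSpace X] [ChartedSpace H X]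
  [IsManifold I ∞ X]

/-- **gr.S14** (vacuum initial data set `(Σ, h, k)` and constraint equations; Choquet-Bruhat 2009,
Ch. VI–VII; Ringström 2009). An **initial data set** on the manifold `X` (modelled on `I`): a
smooth Riemannian metric `h` on `X` (Mathlib's `Bundle.ContMDiffRiemannianMetric` on the tangent
bundle) and a smooth field `k` of symmetric continuous bilinear forms on `TX`. Physically `k` is
the second fundamental form of `X` in the development, with respect to the **future** unit normal
`ν` and the sign convention `K_ν(v, w) = + g(D_v ν, df w)` (Wald (10.2.13)). The constraint
equations are *not* part of the structure (see `IsVacuumConstraintSolution`,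
`SatisfiesDominantEnergyCondition`). Choquet-Bruhat 2009, Ch. VI, Def. 3.1 ff.; Bartnik–Isenberg
2004, §2. [cite: ChoquetBruhat2009, Ch. VI–VII] -/
structure InitialDataSet where
  /-- The Riemannian metric `h` of the data. -/
  h : ContMDiffRiemannianMetric I ∞ E (TangentSpace I : X → Type _)
  /-- The symmetric `2`-tensor `k` (second fundamental form w.r.t. the future unit normal). -/
  k (x : X) : TangentSpace I x →L[ℝ] TangentSpace I x →L[ℝ] ℝ
  /-- `k` is symmetric. -/
  k_symm (x : X) (v w : TangentSpace I x) : k x v w = k x w v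
  /-- `k` is a smooth section of the bundle of bilinear forms on `TX`. -/
  contMDiff_k : ContMDiff I (I.prod 𝓘(ℝ, E →L[ℝ] E →L[ℝ] ℝ)) ∞
    (fun x ↦ TotalSpace.mk' (E →L[ℝ] E →L[ℝ] ℝ) x (k x))

namespace InitialDataSet

variable {I X}

/-- The metric `h` of an initial data set as a (Riemannian) `PseudoRiemannianMetric` on `TX`, so
that the curvature/trace/divergence API applies. Choquet-Bruhat 2009, Ch. VI. [cite: ChoquetBruhat2009, Ch. VI] -/
def metric (D : InitialDataSet I X) : PseudoRiemannianMetric I ∞ E (TangentSpace I : X → Type _) :=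
  PseudoRiemannianMetric.ofRiemannian D.h

/-- The metric of an initial data set at `x` is `h_x`. [folklore] -/
@[simp]
lemma val_metric (D : InitialDataSet I X) : D.metric.val = D.h.inner := rfl

/-- The metric of an initial data set is Riemannian. [folklore] -/
lemma isRiemannian_metric (D : InitialDataSet I X) : D.metric.IsRiemannian :=
  PseudoRiemannianMetric.isRiemannian_ofRiemannian D.h

/-- `k_x` as an algebraic bilinear form. [folklore] -/
def kBilin (D : InitialDataSet I X) (x : X) : LinearMap.BilinForm ℝ (TangentSpace I x) :=
  (D.k x).toLinearMap₁₂

/-- Unfolding lemma for `kBilin`. [folklore] -/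
@[simp]
lemma kBilin_apply (D : InitialDataSet I X) (x : X) (v w : TangentSpace I x) :
    D.kBilin x v w = D.k x v w := rfl

section FiniteDimensional

variable [FiniteDimensional ℝ E]

/-- The **mean curvature** `tr_h k (x) = h^{ij} k_{ij}` of the data at `x`.
Choquet-Bruhat 2009, Ch. VI, (3.9); Bartnik–Isenberg 2004, §2. [cite: ChoquetBruhat2009, Ch. VI  (3.9] -/
def traceK (D : InitialDataSet I X) (x : X) : ℝ :=
  D.metric.trace x (D.kBilin x)

/-- The square norm `|k|²_h (x) = k_{ij} k^{ij}` of `k` at `x`.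
Choquet-Bruhat 2009, Ch. VI, (3.9); Bartnik–Isenberg 2004, §2. [cite: ChoquetBruhat2009, Ch. VI  (3.9] -/
def normSqK (D : InitialDataSet I X) (x : X) : ℝ :=
  D.metric.normSq x (D.kBilin x)

variable [CompleteSpace E]

/-- The **Hamiltonian constraint function** `R(h) - |k|²_h + (tr_h k)²` at `x` (twice the
normal–normal component `2 G(ν, ν)` of the Einstein tensor of any development, by the Gauss
equation); it equals `16π μ`. Choquet-Bruhat 2009, Ch. VI, (3.12) and Ch. VII, (1.2);
Bartnik–Isenberg 2004, (2.1); Wald (10.2.28). [cite: ChoquetBruhat2009, Ch. VI  (3.12] -/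
def hamiltonianConstraintFn (D : InitialDataSet I X) [D.metric.HasLeviCivita] (x : X) : ℝ :=
  D.metric.scalarCurvature x - D.normSqK x + D.traceK x ^ 2

/-- The **momentum constraint covector** `div_h k - d(tr_h k)` at `x` (the normal–tangential
component `-G(ν, ·)` of the Einstein tensor of any development, by the Codazzi equation, in the
sign convention (h)); it equals `8π J`. Choquet-Bruhat 2009, Ch. VI, (3.11) and Ch. VII, (1.1);
Bartnik–Isenberg 2004, (2.2); Wald (10.2.29). [cite: ChoquetBruhat2009, Ch. VI  (3.11] -/
def momentumConstraintFn (D : InitialDataSet I X) [D.metric.HasLeviCivita] (x : X) :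
    TangentSpace I x →ₗ[ℝ] ℝ :=
  D.metric.divergence D.k x -
    (show TangentSpace I x →L[ℝ] ℝ from mfderiv I 𝓘(ℝ, ℝ) D.traceK x).toLinearMap

omit [CompleteSpace E] in
/-- Unfolding lemma: `(div_h k - d(tr_h k))(v) = (div_h k)(v) - d(tr_h k)(v)`.
Bartnik–Isenberg 2004, (2.2). [cite: BartnikIsenberg2004, (2.2] -/
lemma momentumConstraintFn_apply (D : InitialDataSet I X) [D.metric.HasLeviCivita] (x : X)
    (v : TangentSpace I x) :
    D.momentumConstraintFn x v =
      D.metric.divergence D.k x v - (show ℝ from mfderiv I 𝓘(ℝ, ℝ) D.traceK x v) := rfl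

/-- The **energy density** `μ = (R(h) - |k|²_h + (tr_h k)²) / (16π)` of the data at `x` (the
`T(ν, ν)` of any matter model whose development satisfies the Einstein equations
`G = 8π T`). Choquet-Bruhat 2009, Ch. VII, (1.2); Bartnik–Isenberg 2004, (2.1). [cite: ChoquetBruhat2009, Ch. VII  (1.2] -/
def energyDensity (D : InitialDataSet I X) [D.metric.HasLeviCivita] (x : X) : ℝ :=
  D.hamiltonianConstraintFn x / (16 * Real.pi)

/-- The **momentum density** covector `J = (div_h k - d(tr_h k)) / (8π)` of the data at `x`.
Choquet-Bruhat 2009, Ch. VII, (1.1); Bartnik–Isenberg 2004, (2.2). [cite: ChoquetBruhat2009, Ch. VII  (1.1] -/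
def momentumDensity (D : InitialDataSet I X) [D.metric.HasLeviCivita] (x : X) :
    TangentSpace I x →ₗ[ℝ] ℝ :=
  (8 * Real.pi)⁻¹ • D.momentumConstraintFn x

/-- The data satisfy the **vacuum constraint equations**:
`R(h) - |k|²_h + (tr_h k)² = 0` and `div_h k - d(tr_h k) = 0` at every point (both equations are
insensitive to the sign convention for `k`). Choquet-Bruhat 2009, Ch. VI, Thm. 3.3 and (3.11)–
(3.12); Bartnik–Isenberg 2004, (2.1)–(2.2) with `μ = 0`, `J = 0`. [cite: ChoquetBruhat2009, Ch. VI  Thm. 3.3 and (3.11] -/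
def IsVacuumConstraintSolution (D : InitialDataSet I X) [D.metric.HasLeviCivita] : Prop :=
  ∀ x, D.hamiltonianConstraintFn x = 0 ∧ D.momentumConstraintFn x = 0

/-- The data satisfy the **dominant energy condition** `|J|_h ≤ μ` at every point, where
`|J|²_h = h^{ij} J_i J_j` (`PseudoRiemannianMetric.innerDual`). Bartnik–Isenberg 2004, §2
(below (2.2)); Schoen–Yau 1981; Choquet-Bruhat 2009, Ch. VII. [cite: BartnikIsenberg2004, §2 (below (2.2] -/
def SatisfiesDominantEnergyCondition (D : InitialDataSet I X) [D.metric.HasLeviCivita] : Prop :=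
  ∀ x, Real.sqrt (D.metric.innerDual x (D.momentumDensity x) (D.momentumDensity x))
    ≤ D.energyDensity x

/-- The data are **maximal**: `tr_h k = 0` identically (the slice is a maximal hypersurface of
its development). Bartnik–Isenberg 2004, §2 (maximal slicing); Choquet-Bruhat 2009, Ch. VII, §3. [cite: BartnikIsenberg2004, §2 (maximal slicing] -/
def IsMaximalData (D : InitialDataSet I X) : Prop :=
  ∀ x, D.traceK x = 0

end FiniteDimensional

/-- The data are **time-symmetric**: `k = 0` identically (the slice is totally geodesic; the
development is invariant under time reflection). Bartnik–Isenberg 2004, §2; Choquet-Bruhat 2009,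
Ch. VII. [cite: BartnikIsenberg2004, §2] -/
def IsTimeSymmetric (D : InitialDataSet I X) : Prop :=
  ∀ x, D.k x = 0

section FiniteDimensional

variable [FiniteDimensional ℝ E]

/-- Time-symmetric data are maximal. [folklore] -/
lemma IsTimeSymmetric.isMaximalData {D : InitialDataSet I X} (hD : D.IsTimeSymmetric) :
    D.IsMaximalData := by
  intro x
  have h0 : D.kBilin x = 0 := LinearMap.ext₂ fun v w ↦ by simp [hD x]
  simp [traceK, PseudoRiemannianMetric.trace, h0]

/-- For time-symmetric data `|k|²_h = 0`. [folklore] -/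
lemma IsTimeSymmetric.normSqK_eq_zero {D : InitialDataSet I X} (hD : D.IsTimeSymmetric) (x : X) :
    D.normSqK x = 0 := by
  have h0 : D.kBilin x = 0 := LinearMap.ext₂ fun v w ↦ by simp [hD x]
  simp [normSqK, PseudoRiemannianMetric.normSq, h0]

variable [CompleteSpace E]

omit [FiniteDimensional ℝ E] [CompleteSpace E] in
/-- The covariant derivative of the zero field of bilinear forms vanishes (`∇0 = 0`; the defining
trilinear map is unique and `0` qualifies, `mvfderiv_const`). O'Neill 1983, Ch. 3, Prop. 3.18.
[folklore] -/
theorem _root_.Literature.Geometry.Lorentzian.PseudoRiemannianMetric.covDeriv₂_zero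
    (g : PseudoRiemannianMetric I ∞ E (TangentSpace I : X → Type _)) [g.HasLeviCivita] (x : X) :
    g.covDeriv₂ (fun _ ↦ 0) x = 0 := by
  have haux : ∀ X₁ Y₁ Z₁ : Π x : X, TangentSpace I x,
      g.covDeriv₂Aux (fun _ ↦ 0) X₁ Y₁ Z₁ x = 0 := by
    intro X₁ Y₁ Z₁
    simp [PseudoRiemannianMetric.covDeriv₂Aux, mvfderiv_const]
  unfold PseudoRiemannianMetric.covDeriv₂
  have hex :
      ∃ K : TangentSpace I x →L[ℝ] TangentSpace I x →L[ℝ] TangentSpace I x →L[ℝ] ℝ,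
      ∀ X₀ Y₀ Z₀ : TangentSpace I x, K X₀ Y₀ Z₀ = g.covDeriv₂Aux (fun _ ↦ 0)
        (FiberBundle.extend E X₀) (FiberBundle.extend E Y₀) (FiberBundle.extend E Z₀) x :=
    ⟨0, fun _ _ _ ↦ by simp [haux]⟩
  rw [dif_pos hex]
  ext X₀ Y₀ Z₀
  simpa [haux] using hex.choose_spec X₀ Y₀ Z₀

omit [CompleteSpace E] in
/-- For time-symmetric data the momentum constraint covector vanishes identically
(`k = 0`, `tr_h k = 0`, so `div_h k - d(tr_h k) = 0`). Bartnik–Isenberg 2004, §2.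
[cite: BartnikIsenberg2004, §2] -/
theorem IsTimeSymmetric.momentumConstraintFn_eq_zero {D : InitialDataSet I X}
    [D.metric.HasLeviCivita] (hD : D.IsTimeSymmetric) (x : X) :
    D.momentumConstraintFn x = 0 := by
  have hk : D.k = fun _ ↦ 0 := funext hD
  have htr : D.traceK = fun _ ↦ 0 := funext hD.isMaximalData
  have hdiv : D.metric.divergence D.k x = 0 := by
    ext v
    have h0 : D.metric.divergenceAux D.k x v = 0 := LinearMap.ext₂ fun X₀ Z₀ ↦ by
      simp [hk, PseudoRiemannianMetric.covDeriv₂_zero]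
    simp [PseudoRiemannianMetric.divergence, PseudoRiemannianMetric.trace, h0]
  ext v
  rw [momentumConstraintFn_apply, hdiv, htr]
  simp only [mfderiv_const, LinearMap.zero_apply]
  exact sub_self 0

omit [CompleteSpace E] in
/-- For **time-symmetric** data (`k = 0`) the vacuum constraint equations reduce to the single
scalar equation `R(h) = 0`: the momentum constraint `div k - d(tr k) = 0` holds trivially and the
Hamiltonian constraint becomes `R(h) = 0`. Bartnik–Isenberg 2004, §2; Choquet-Bruhat 2009,
Ch. VII. [cite: BartnikIsenberg2004, §2] -/
theorem isVacuumConstraintSolution_iff_of_isTimeSymmetric {D : InitialDataSet I X}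
    [D.metric.HasLeviCivita] (hD : D.IsTimeSymmetric) :
    D.IsVacuumConstraintSolution ↔ ∀ x, D.metric.scalarCurvature x = 0 := by
  refine forall_congr' fun x ↦ ?_
  simp [hamiltonianConstraintFn, hD.normSqK_eq_zero, hD.isMaximalData x,
    hD.momentumConstraintFn_eq_zero x]

/-- The data are **complete**: the Riemannian manifold `(X, h)` is complete, expressed as
geodesic completeness of the Levi-Civita connection of `h` (equivalent to completeness of the
Riemannian distance by the Hopf–Rinow theorem, which is not in Mathlib). Bartnik–Isenberg 2004,
§2; O'Neill 1983, Ch. 5, Thm. 5.21 (Hopf–Rinow). [cite: BartnikIsenberg2004, §2] -/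
def IsComplete (D : InitialDataSet I X) [D.metric.HasLeviCivita] : Prop :=
  IsGeodesicallyComplete D.metric.leviCivita

end FiniteDimensional

/-! ### Restriction to an open subset -/

/-- The unit ball of `h` at a point of an open subset `U ⊆ X` is von Neumann bounded in
`T_x U = T_x X` (transport of `ContMDiffRiemannianMetric.isVonNBounded` along the definitional
equality of the fibres). [folklore] -/
theorem isVonNBounded_restrict (D : InitialDataSet I X) (U : Opens X) (x : U) :
    Bornology.IsVonNBounded ℝ {v : TangentSpace I x | D.h.inner x.1 v v < 1} :=
  D.h.isVonNBounded x.1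

/-- The restriction of the smooth section `k` of the bundle of bilinear forms on `TX` to an open
subset `U ⊆ X` is a smooth section of the bundle of bilinear forms on `TU` (the charts of `U` are
the restrictions of the charts of `X`; compare `PseudoRiemannianMetric.contMDiff_restrict`).
Named fact, threaded as the explicit hypothesis `hk` of `InitialDataSet.restrict` (same pattern
as `PseudoRiemannianMetric.contMDiff_restrict`). O'Neill 1983, Ch. 3, p. 57 (open
submanifolds). [cite: ONeill1983, Ch. 3  p. 57 (open submanifolds] -/
def contMDiff_k_restrict : Prop :=
  ∀ (D : InitialDataSet I X) (U : Opens X),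
    ContMDiff I (I.prod 𝓘(ℝ, E →L[ℝ] E →L[ℝ] ℝ)) ∞
      (fun x : U ↦ TotalSpace.mk' (F := E →L[ℝ] E →L[ℝ] ℝ)
        (E := fun y : U ↦ TangentSpace I y →L[ℝ] TangentSpace I y →L[ℝ] ℝ) x (D.k x.1))

/-- The **restriction** `D|_U = (h|_U, k|_U)` of an initial data set to an open subset
`U : Opens X` (an open submanifold with `T_x U = T_x X = E` definitionally); smoothness of the
restricted sections is supplied by the named facts
`hres : PseudoRiemannianMetric.contMDiff_restrict` and `hk : InitialDataSet.contMDiff_k_restrict`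
(explicit hypotheses). Bartnik–Isenberg 2004, §2
(local character of the constraints); Choquet-Bruhat 2009, Ch. VI. [cite: BartnikIsenberg2004, §2 (local character of the constraints] -/
def restrict (D : InitialDataSet I X)
    (hres : PseudoRiemannianMetric.contMDiff_restrict (I := I) (n := ∞) (M := X))
    (hk : contMDiff_k_restrict (I := I) (X := X)) (U : Opens X) : InitialDataSet I U where
  h :=
    { inner := fun x ↦ D.h.inner x.1
      symm := fun x ↦ D.h.symm x.1
      pos := fun x ↦ D.h.pos x.1
      isVonNBounded := D.isVonNBounded_restrict U
      contMDiff := hres D.metric U }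
  k x := D.k x.1
  k_symm x := D.k_symm x.1
  contMDiff_k := hk D U

/-- The metric of the restricted data at `x : U` is `h` at `↑x`. [folklore] -/
@[simp]
lemma h_inner_restrict (D : InitialDataSet I X)
    (hres : PseudoRiemannianMetric.contMDiff_restrict (I := I) (n := ∞) (M := X))
    (hk : contMDiff_k_restrict (I := I) (X := X)) (U : Opens X) (x : U) :
    (D.restrict hres hk U).h.inner x = D.h.inner x.1 := rfl

/-- The tensor `k` of the restricted data at `x : U` is `k` at `↑x`. [folklore] -/
@[simp]
lemma k_restrict (D : InitialDataSet I X)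
    (hres : PseudoRiemannianMetric.contMDiff_restrict (I := I) (n := ∞) (M := X))
    (hk : contMDiff_k_restrict (I := I) (X := X)) (U : Opens X) (x : U) :
    (D.restrict hres hk U).k x = D.k x.1 := rfl

end InitialDataSet

end Literature.Geometry.Lorentzian

end
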